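import Mathlib
import HarnessLib
import Summits.NavierStokesRegularity.NavierStokesRegularity.Theorems.AxisTwistDoorAveragedConeLiouvilleSmallScales
import Summits.NavierStokesRegularity.NavierStokesRegularity.Theorems.AxisTwistDoorAveragedConeLiouvilleSmoothRep
import Summits.NavierStokesRegularity.NavierStokesRegularity.Theorems.AxisTwistDoorAveragedConeLiouvilleUnzoom

/-!
# Route `AxisTwistDoor`, crux `AveragedConeLiouville` (stmt-NavierStokesRegularity-26889) — toward replacing the
# Lei–Ren input (programme R2), piece S6b (interior part): EVENTUAL POINTWISE BOUNDS ON A COMPACT SET OF INTERIOR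
# REGULAR POINTS

Interior twin of `…LidBounds.eventually_bounds_near_lid`: for suitable weak solutions `(v_k, q_k)` on `Q(0,1)`
(bounded in `L³ × L^{3/2}`, continuous, converging to `u` strongly in `L³` on `K ⊆ Q(0,1)`) and a COMPACT set `K₀` of
space-time points at which the limit `u` is regular (`IsRegularPoint`, centred cylinders), with room above and
around (`Q((t′, x), r) ⊆ K` for `t ≤ t′ ≤ t + s_cap²/8`), there are bounds `B, B′` with `‖v_k(w)‖ ≤ B`,
`‖∇v_k(w)‖ ≤ B′` at EVERY `w ∈ K₀` for all large `k` (`eventually_bounds_interior`).  The vertices used are the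
shifted points `w′ = (t + s²/8, x)` (so that `w ∈ Q(w′, s/2)`), whose cylinders `Q(w′, r₁)` lie in the doubled
centred cylinders of a finite subcover.

Seat ns-atd-p1 (LEAD g2).  WHAT THIS IS NOT: not a statement about Navier–Stokes regularity; a compactness tool
serving a STAGED door route.  Lands `--supports` the crux item as a helper.
-/

noncomputable section

set_option linter.dupNamespace false

namespace Summit.NavierStokesRegularity.NavierStokesRegularity.Theorems.AveragedConeLiouville.InteriorBounds

open scoped ENNReal NNReal Topology
open Set Function MeasureTheory Metric Filter TopologicalSpace
open Literature.Analysis.FluidPDE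
open Summit.NavierStokesRegularity.NavierStokesRegularity.Theorems.AveragedConeLiouville.SmallScales
open Summit.NavierStokesRegularity.NavierStokesRegularity.Theorems.AveragedConeLiouville.SmoothRep
open Summit.NavierStokesRegularity.NavierStokesRegularity.Theorems.AveragedConeLiouville.Unzoom

/-- The cylinder below the shifted vertex `w′ = (t_w + s²/8, x_w)` lies in the doubled centred cylinder of the cover:
if `w ∈ Q*_{ρ/2}(w₀)`, `r₁ ≤ ρ/2`, `0 < s ≤ r₁`, then `Q((t_w + s²/8, x_w), r₁) ⊆ Q*_ρ(w₀)`. -/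
theorem parabolicCylinder_vertex_subset {w w₀ : ℝ × EuclideanSpace ℝ (Fin 3)} {ρ r₁ s : ℝ}
    (hw : w ∈ parabolicCylinderCentered (ρ / 2) w₀) (hr₁ : r₁ ≤ ρ / 2) (hs : 0 < s) (hsr : s ≤ r₁) :
    parabolicCylinder r₁ ((w.1 + s ^ 2 / 8, w.2) : ℝ × EuclideanSpace ℝ (Fin 3)) ⊆ parabolicCylinderCentered ρ w₀ := by
  rw [mem_parabolicCylinderCentered] at hw
  obtain ⟨⟨hw1, hw2⟩, hw3⟩ := hw
  rintro ⟨t, y⟩ h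
  rw [mem_parabolicCylinder] at h
  rw [mem_parabolicCylinderCentered]
  obtain ⟨⟨h1, h2⟩, h3⟩ := h
  simp only at h1 h2 h3 ⊢
  have hρ : 0 < ρ := by linarith
  have hs2 : s ^ 2 ≤ r₁ ^ 2 := pow_le_pow_left₀ hs.le hsr 2
  have hr2 : r₁ ^ 2 ≤ ρ ^ 2 / 4 := by nlinarith
  refine ⟨⟨by nlinarith, by nlinarith⟩, ?_⟩
  calc dist y w₀.2 ≤ dist y w.2 + dist w.2 w₀.2 := dist_triangle _ _ _
    _ < r₁ + ρ / 2 := add_lt_add h3 hw3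
    _ ≤ ρ := by linarith

/-- The point `w` lies in the half-cylinder below its shifted vertex: `w ∈ Q((t_w + s²/8, x_w), s/2)`. -/
theorem mem_parabolicCylinder_vertex (w : ℝ × EuclideanSpace ℝ (Fin 3)) {s : ℝ} (hs : 0 < s) :
    w ∈ parabolicCylinder (s / 2) ((w.1 + s ^ 2 / 8, w.2) : ℝ × EuclideanSpace ℝ (Fin 3)) := by
  rw [mem_parabolicCylinder]
  simp only [dist_self]
  refine ⟨⟨by nlinarith, by nlinarith⟩, by positivity⟩

/-- **Eventual pointwise bounds on a compact set of interior regular points.** -/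
theorem eventually_bounds_interior
    {v : ℕ → ℝ → EuclideanSpace ℝ (Fin 3) → EuclideanSpace ℝ (Fin 3)}
    {q : ℕ → ℝ → EuclideanSpace ℝ (Fin 3) → ℝ}
    {u : ℝ → EuclideanSpace ℝ (Fin 3) → EuclideanSpace ℝ (Fin 3)}
    (hball : ∀ k, IsSuitableWeakSolutionInBall 1 0 (v k) (q k))
    (hcont : ∀ k, ContinuousOn (uncurry (v k)) (parabolicCylinder 1 (0 : ℝ × EuclideanSpace ℝ (Fin 3))))
    (hsup : (⨆ k, (eLpNorm (uncurry (v k)) 3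
        (volume.restrict (parabolicCylinder 1 (0 : ℝ × EuclideanSpace ℝ (Fin 3)))) +
      eLpNorm (uncurry (q k)) (3 / 2)
        (volume.restrict (parabolicCylinder 1 (0 : ℝ × EuclideanSpace ℝ (Fin 3)))))) < ∞)
    {K : Set (ℝ × EuclideanSpace ℝ (Fin 3))} (hKO : K ⊆ parabolicCylinder 1 (0 : ℝ × EuclideanSpace ℝ (Fin 3)))
    (hlim : Tendsto (fun k => eLpNorm (uncurry (v k) - uncurry u) 3 (volume.restrict K)) atTop (𝓝 0))
    {K₀ : Set (ℝ × EuclideanSpace ℝ (Fin 3))} (hK₀ : IsCompact K₀) {r scap : ℝ} (hr : 0 < r) (hscap : 0 < scap)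
    (hroom : ∀ w ∈ K₀, ∀ t' ∈ Icc w.1 (w.1 + scap ^ 2 / 8),
      parabolicCylinder r ((t', w.2) : ℝ × EuclideanSpace ℝ (Fin 3)) ⊆ K)
    (hreg : ∀ w ∈ K₀, IsRegularPoint u w) :
    ∃ B B' : ℝ, ∀ᶠ k in atTop, ∀ w ∈ K₀, ‖v k w.1 w.2‖ ≤ B ∧ ‖fderiv ℝ (v k w.1) w.2‖ ≤ B' := by
  -- radii and levels of regularity
  have hrad : ∀ w ∈ K₀, ∃ ρ : ℝ, 0 < ρ ∧ eLpNorm (uncurry u) ∞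
      (volume.restrict (parabolicCylinderCentered ρ w)) ≠ ∞ := by
    intro w hw
    obtain ⟨ρ, hρ, hfin⟩ := hreg w hw
    exact ⟨ρ, hρ, hfin.ne⟩
  choose! ρ hρ hfin using hrad
  -- finite subcover of `K₀` by the cylinders `Q*_{ρ_w/2}(w)`
  have hself : ∀ w ∈ K₀, w ∈ parabolicCylinderCentered (ρ w / 2) w := by
    intro w hw
    rw [mem_parabolicCylinderCentered, dist_self]
    have := hρ w hw
    exact ⟨⟨by nlinarith, by nlinarith⟩, by linarith⟩
  obtain ⟨J, hJsub, hJfin, hJcov⟩ := hK₀.elim_finite_subcover_image (b := K₀)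
    (c := fun w => parabolicCylinderCentered (ρ w / 2) w)
    (fun w _ => isOpen_parabolicCylinderCentered _ _) (fun w hw => mem_iUnion₂.2 ⟨w, hw, hself w hw⟩)
  rcases K₀.eq_empty_or_nonempty with hKe | hKne
  · refine ⟨0, 0, Eventually.of_forall fun k w hw => ?_⟩
    rw [hKe] at hw; exact absurd hw (notMem_empty w)
  have hJne : J.Nonempty := by
    obtain ⟨w, hw⟩ := hKne
    obtain ⟨i, hi, -⟩ := mem_iUnion₂.1 (hJcov hw)
    exact ⟨i, hi⟩
  obtain ⟨Jf, hJf⟩ := hJfin.exists_finset_coe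
  have hJfne : Jf.Nonempty := by
    obtain ⟨i, hi⟩ := hJne
    exact ⟨i, by rw [← Finset.mem_coe, hJf]; exact hi⟩
  have hJfK : ∀ i ∈ Jf, i ∈ K₀ := fun i hi => hJsub (by rw [← hJf]; exact Finset.mem_coe.2 hi)
  -- uniform radius and level
  set r₁ : ℝ := min (min r scap) (Jf.inf' hJfne fun i => ρ i / 2) with hr₁
  have hr₁pos : 0 < r₁ := by
    refine lt_min (lt_min hr hscap) ?_
    obtain ⟨i, hi, heq⟩ := Finset.exists_mem_eq_inf' hJfne fun i => ρ i / 2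
    rw [heq]; linarith [hρ i (hJfK i hi)]
  have hr₁r : r₁ ≤ r := (min_le_left _ _).trans (min_le_left _ _)
  have hr₁s : r₁ ≤ scap := (min_le_left _ _).trans (min_le_right _ _)
  have hr₁ρ : ∀ i ∈ Jf, r₁ ≤ ρ i / 2 := fun i hi => (min_le_right _ _).trans (Finset.inf'_le _ hi)
  set M : ℝ≥0∞ := Jf.sup fun i => eLpNorm (uncurry u) ∞
    (volume.restrict (parabolicCylinderCentered (ρ i) i)) with hM
  have hMtop : M ≠ ∞ := by
    rw [hM, ne_eq, Finset.sup_eq_top_iff]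
    push Not
    intro i hi
    exact hfin i (hJfK i hi)
  -- the universal constants of the smooth representative, and one small scale
  obtain ⟨εS, hεS, c₀, hrep⟩ := exists_smooth_rep_of_small
  obtain ⟨s, hs, hsr₁, hev⟩ := eventually_small_cknC_add_cknD hball hsup hKO hlim hr₁pos hMtop hεS
  refine ⟨c₀ 0 / s, c₀ 1 / s ^ 2, ?_⟩
  filter_upwards [hev] with k hk w hw
  -- the shifted vertex
  set w' : ℝ × EuclideanSpace ℝ (Fin 3) := (w.1 + s ^ 2 / 8, w.2) with hw'
  obtain ⟨i, hi, hwi⟩ := mem_iUnion₂.1 (hJcov hw)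
  have hiJf : i ∈ Jf := by rw [← Finset.mem_coe, hJf]; exact hi
  have hsub1 : parabolicCylinder r₁ w' ⊆ parabolicCylinderCentered (ρ i) i :=
    parabolicCylinder_vertex_subset hwi (hr₁ρ i hiJf) hs hsr₁
  have hKw : parabolicCylinder r₁ w' ⊆ K := by
    refine (parabolicCylinder_mono hr₁pos.le hr₁r _).trans (hroom w hw w'.1 ⟨by simp [hw']; positivity, ?_⟩)
    simp only [hw']
    have : s ^ 2 ≤ scap ^ 2 := pow_le_pow_left₀ hs.le (hsr₁.trans hr₁s) 2
    linarith
  have hMbound : ∀ᵐ z ∂(volume.restrict (parabolicCylinder r₁ w')), ‖u z.1 z.2‖ₑ ≤ M := by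
    have h1 := ae_restrict_of_ae_restrict_of_subset hsub1 (ae_enorm_le_eLpNorm_top u (parabolicCylinderCentered (ρ i) i))
    filter_upwards [h1] with z hz
    exact hz.trans (Finset.le_sup (f := fun i => eLpNorm (uncurry u) ∞
      (volume.restrict (parabolicCylinderCentered (ρ i) i))) hiJf)
  have hsmall := hk w' hKw hMbound
  have hsubs : parabolicCylinder s w' ⊆ parabolicCylinder 1 (0 : ℝ × EuclideanSpace ℝ (Fin 3)) :=
    ((parabolicCylinder_mono hs.le hsr₁ _).trans hKw).trans hKO
  obtain ⟨W, hae, hWd, hWk⟩ := hrep (v k) (q k) w' s hs (hball k) hsubs hsmall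
  obtain ⟨⟨C0, α0, hα0, hH0⟩, hb0⟩ := hWk 0
  obtain ⟨-, hb1⟩ := hWk 1
  have hWc : ContinuousOn (uncurry W) (parabolicCylinder (1 / 2) (0 : ℝ × EuclideanSpace ℝ (Fin 3))) := by
    have h1 := hH0.continuousOn hα0
    have h2 : uncurry W = (continuousMultilinearCurryFin0 ℝ (EuclideanSpace ℝ (Fin 3)) (EuclideanSpace ℝ (Fin 3))) ∘
        (fun w : ℝ × EuclideanSpace ℝ (Fin 3) => iteratedFDeriv ℝ 0 (W w.1) w.2) := by
      funext w
      simp [iteratedFDeriv_zero_eq_comp, uncurry]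
    rw [h2]
    exact (continuousMultilinearCurryFin0 ℝ (EuclideanSpace ℝ (Fin 3)) (EuclideanSpace ℝ (Fin 3))).continuous.comp_continuousOn h1
  have hWdiff : ∀ w' ∈ parabolicCylinder (1 / 2) (0 : ℝ × EuclideanSpace ℝ (Fin 3)), DifferentiableAt ℝ (W w'.1) w'.2 :=
    fun w' hw' => (hWd w' hw').differentiableAt (by simp)
  have h0 : ∀ w' ∈ parabolicCylinder (1 / 2) (0 : ℝ × EuclideanSpace ℝ (Fin 3)), ‖W w'.1 w'.2‖ ≤ c₀ 0 := by
    intro w' hw'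
    have := hb0 w' hw'
    rwa [norm_iteratedFDeriv_zero] at this
  have hvc : ContinuousOn (uncurry (v k)) (parabolicCylinder s w') := (hcont k).mono hsubs
  exact pointwise_bounds_of_smooth_rep hs hvc hae hWc hWdiff h0 hb1 w (mem_parabolicCylinder_vertex w hs)

end Summit.NavierStokesRegularity.NavierStokesRegularity.Theorems.AveragedConeLiouville.InteriorBounds

end
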